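import Literature.Analysis.Calculus.HardyLastZero
import Mathlib.Topology.MetricSpace.HausdorffDistance
import HarnessLib

/-!
# Hardy's inequality relative to a closed set of zeros:
# `∫ ‖u‖²/dist(·, K)² ≤ 8 ∫ ‖u'‖²` for `u` vanishing on `K`

Analysis/Calculus support file (everything proved; no definitions, no named facts). The form of
Hardy's inequality used to control a Sobolev function near its zero set along a line (the
one-dimensional core of `∫ |u|²/dist(·, F)² ≤ C ∫ |∇u|²` for `H¹` functions vanishing on a closed
set `F`, applied on a.e. line transversal to `F`; Maz'ya, *Sobolev Spaces*, §2.3.3; for `K = {0}`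
Hardy–Littlewood–Pólya Thm. 327). With the last zero `a(t) = sup (K ∩ (-∞, t])` of `HardyLastZero`
and the next zero `b(t) = inf (K ∩ [t, ∞))` (obtained by reflection `t ↦ -t`):

* `lintegral_enorm_sq_div_sq_nextZero_le` — mirror image of
  `lintegral_enorm_sq_div_sq_lastZero_le`: `∫⁻_{(t₀,t₁) ∖ K} ‖u‖²/(b(t) - t)² ≤ 4 ∫⁻_{(t₀,t₁)} ‖h‖²`
  when `u(t) = -∫_t^{b(t)} h` off `K`, `t₁ ∈ K`;
* `inv_infDist_sq_le` — `1/dist(t,K)² ≤ 1/(t-a(t))² + 1/(b(t)-t)²` (`t ∉ K`);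
* `lintegral_enorm_sq_div_infDist_sq_le` — **two-sided form**: `K` closed and unbounded in both
  directions, window `(t₀, t₁)` with `t₀, t₁ ∈ K`, `u(t) - u(s) = ∫ₛᵗ h` on `[t₀, t₁]` and `u = 0`
  on `K ∩ [t₀, t₁]`; then `∫⁻_{(t₀,t₁)} ‖u(t)‖² / dist(t, K)² dt ≤ 8 ∫⁻_{(t₀,t₁)} ‖h‖²`.

## Mathlib / tree search

Mathlib: `Metric.infDist`, `Metric.le_infDist`, `Measure.measurePreserving_neg`; no Hardy
inequality. Tree: `HardyLastZero`, `HardyPrimitive`.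

## References

* G. H. Hardy, J. E. Littlewood, G. Pólya, *Inequalities*, 2nd ed., Cambridge (1952), Thm. 327.
  [HardyLittlewoodPolya1952]
* V. Maz'ya, *Sobolev Spaces*, 2nd ed., Springer (2011), §2.3.3 (Hardy-type inequalities with the
  distance to a set).
-/

noncomputable section

open MeasureTheory Set Filter Metric
open scoped ENNReal NNReal Topology

namespace Literature.Analysis.Calculus

section Bochner

variable {E : Type*} [NormedAddCommGroup E] [NormedSpace ℝ E]

/-- **Hardy relative to the next zero** (mirror image): `K` closed and unbounded above,
`b(t) = inf (K ∩ [t, ∞))`, window `(t₀, t₁)` with `t₁ ∈ K`, `u(t) = -∫_t^{b(t)} h` off `K`. Then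
`∫⁻_{(t₀,t₁) ∖ K} ‖u(t)‖² / (b(t) - t)² ≤ 4 ∫⁻_{(t₀,t₁)} ‖h‖²`. [cite: HardyLittlewoodPolya1952, Thm. 327] -/
theorem lintegral_enorm_sq_div_sq_nextZero_le {K : Set ℝ} (hK : IsClosed K)
    (hne : ∀ t : ℝ, (K ∩ Ici t).Nonempty) {t₀ t₁ : ℝ} (ht₁ : t₁ ∈ K) {u h : ℝ → E}
    (hh : AEStronglyMeasurable h (volume.restrict (Ioo t₀ t₁)))
    (hu : ∀ t ∈ Ioo t₀ t₁ \ K, u t = -∫ s in t..(sInf (K ∩ Ici t)), h s) :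
    ∫⁻ t in Ioo t₀ t₁ \ K, ‖u t‖ₑ ^ 2 / ENNReal.ofReal ((sInf (K ∩ Ici t) - t) ^ 2) ≤
      4 * ∫⁻ t in Ioo t₀ t₁, ‖h t‖ₑ ^ 2 := by
  -- reflect: `K' = -K`, `u' t = u (-t)`, `h' t = -h (-t)`
  have hneg : MeasurePreserving (fun s : ℝ => -s) volume volume := Measure.measurePreserving_neg volume
  have hemb : MeasurableEmbedding (fun s : ℝ => -s) := (MeasurableEquiv.neg ℝ).measurableEmbedding
  have hK' : IsClosed (-K) := hK.preimage continuous_neg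
  have hne' : ∀ t : ℝ, (-K ∩ Iic t).Nonempty := fun t =>
    neg_inter_Iic_nonempty (by simpa only [neg_neg] using hne (-t))
  have hpre : (fun s : ℝ => -s) ⁻¹' Ioo t₀ t₁ = Ioo (-t₁) (-t₀) := by
    ext s; simp only [mem_preimage, mem_Ioo]; constructor <;> rintro ⟨h1, h2⟩ <;> constructor <;> linarith
  have hmp : MeasurePreserving (fun s : ℝ => -s) (volume.restrict (Ioo (-t₁) (-t₀)))
      (volume.restrict (Ioo t₀ t₁)) := by
    have h1 := hneg.restrict_preimage_emb hemb (Ioo t₀ t₁)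
    rwa [hpre] at h1
  have hh' : AEStronglyMeasurable (fun s => -h (-s)) (volume.restrict (Ioo (-t₁) (-t₀))) :=
    (hh.comp_measurePreserving hmp).neg
  -- the reflected primitive identity
  have hu' : ∀ t ∈ Ioo (-t₁) (-t₀) \ -K, (fun t => u (-t)) t = ∫ s in (sSup (-K ∩ Iic t))..t, -h (-s) := by
    intro t ht
    have ht' : -t ∈ Ioo t₀ t₁ \ K :=
      ⟨⟨by linarith [ht.1.2], by linarith [ht.1.1]⟩, fun h => ht.2 (by simpa using h)⟩
    simp only
    rw [hu (-t) ht', sSup_neg_inter_Iic', intervalIntegral.integral_neg, intervalIntegral.integral_comp_neg,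
      neg_neg]
  have key := lintegral_enorm_sq_div_sq_lastZero_le hK' hne' (by simpa using ht₁ : -t₁ ∈ -K) hh' hu'
  simp only [enorm_neg] at key
  -- transport back
  have hL : ∫⁻ t in Ioo (-t₁) (-t₀) \ -K, ‖u (-t)‖ₑ ^ 2 / ENNReal.ofReal ((t - sSup (-K ∩ Iic t)) ^ 2) =
      ∫⁻ t in Ioo t₀ t₁ \ K, ‖u t‖ₑ ^ 2 / ENNReal.ofReal ((sInf (K ∩ Ici t) - t) ^ 2) := by
    have h1 := hneg.setLIntegral_comp_preimage_emb hemb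
      (fun t => ‖u t‖ₑ ^ 2 / ENNReal.ofReal ((sInf (K ∩ Ici t) - t) ^ 2)) (Ioo t₀ t₁ \ K)
    have hpre2 : (fun s : ℝ => -s) ⁻¹' (Ioo t₀ t₁ \ K) = Ioo (-t₁) (-t₀) \ -K := by
      rw [preimage_sdiff, hpre]; rfl
    rw [hpre2] at h1
    rw [← h1]
    refine setLIntegral_congr_fun (measurableSet_Ioo.diff hK'.measurableSet) fun t _ => ?_
    rw [sSup_neg_inter_Iic' K t]
    congr 2
    ring
  have hR : ∫⁻ t in Ioo (-t₁) (-t₀), ‖h (-t)‖ₑ ^ 2 = ∫⁻ t in Ioo t₀ t₁, ‖h t‖ₑ ^ 2 := by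
    have h1 := hneg.setLIntegral_comp_preimage_emb hemb (fun t => ‖h t‖ₑ ^ 2) (Ioo t₀ t₁)
    rw [hpre] at h1
    exact h1
  rw [hL, hR] at key
  exact key

/-- For closed `K` unbounded on both sides and `t ∉ K`, the distance to `K` is realised by the last
zero before or the next zero after `t`: `1/dist(t,K)² ≤ 1/(t-a(t))² + 1/(b(t)-t)²` in `[0, ∞]`.
[folklore] -/
theorem inv_infDist_sq_le {K : Set ℝ} (hK : IsClosed K) (hne₁ : ∀ t : ℝ, (K ∩ Iic t).Nonempty)
    (hne₂ : ∀ t : ℝ, (K ∩ Ici t).Nonempty) {t : ℝ} (ht : t ∉ K) :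
    (ENNReal.ofReal (infDist t K ^ 2))⁻¹ ≤
      (ENNReal.ofReal ((t - sSup (K ∩ Iic t)) ^ 2))⁻¹ + (ENNReal.ofReal ((sInf (K ∩ Ici t) - t) ^ 2))⁻¹ := by
  set a := sSup (K ∩ Iic t)
  set b := sInf (K ∩ Ici t)
  have ha : a < t := sSup_inter_Iic_lt hK (hne₁ t) ht
  have hb : t < b := by
    have h1 : sSup (-K ∩ Iic (-t)) < -t := sSup_inter_Iic_lt (hK.preimage continuous_neg)
      (neg_inter_Iic_nonempty (by simpa only [neg_neg] using hne₂ t)) (by simpa using ht)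
    rw [sSup_neg_inter_Iic] at h1
    linarith
  -- `dist(t, K) = min (t - a) (b - t)`
  have hge : min (t - a) (b - t) ≤ infDist t K := by
    refine (le_infDist ⟨a, sSup_inter_Iic_mem hK (hne₁ t)⟩).2 fun k hk => ?_
    rcases le_total k t with hkt | hkt
    · have : k ≤ a := le_sSup_inter_Iic hk hkt
      rw [Real.dist_eq, abs_of_nonneg (by linarith)]
      exact (min_le_left _ _).trans (by linarith)
    · have : b ≤ k := by
        have h1 : -k ≤ sSup (-K ∩ Iic (-t)) := le_sSup_inter_Iic (by simpa using hk) (neg_le_neg hkt)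
        rw [sSup_neg_inter_Iic] at h1
        linarith
      rw [Real.dist_eq, abs_of_nonpos (by linarith)]
      exact (min_le_right _ _).trans (by linarith)
  have hpos : 0 < min (t - a) (b - t) := lt_min (sub_pos.2 ha) (sub_pos.2 hb)
  have hsq : ENNReal.ofReal (min (t - a) (b - t) ^ 2) ≤ ENNReal.ofReal (infDist t K ^ 2) :=
    ENNReal.ofReal_le_ofReal (pow_le_pow_left₀ hpos.le hge 2)
  calc (ENNReal.ofReal (infDist t K ^ 2))⁻¹ ≤ (ENNReal.ofReal (min (t - a) (b - t) ^ 2))⁻¹ :=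
        ENNReal.inv_le_inv.2 hsq
    _ ≤ (ENNReal.ofReal ((t - a) ^ 2))⁻¹ + (ENNReal.ofReal ((b - t) ^ 2))⁻¹ := by
        rcases min_choice (t - a) (b - t) with h | h <;> rw [h]
        · exact le_self_add
        · exact le_add_self

/-- **Hardy's inequality relative to a closed zero set, two-sided form.** Let `K ⊆ ℝ` be closed
and unbounded in both directions, `(t₀, t₁)` a window with `t₀, t₁ ∈ K`, `u : ℝ → E` with
`u(t) - u(s) = ∫ₛᵗ h` for `s, t ∈ [t₀, t₁]` (`h` a.e.-strongly measurable on the window) and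
`u = 0` on `K ∩ [t₀, t₁]`. Then
`∫⁻_{(t₀,t₁)} ‖u(t)‖² / dist(t, K)² dt ≤ 8 ∫⁻_{(t₀,t₁)} ‖h‖²`.
(On `K` the integrand is `0/0 = 0`.) Maz'ya, *Sobolev Spaces* §2.3.3 (one-dimensional case);
constant `8 = 2 · 4` from the two one-sided inequalities. [cite: HardyLittlewoodPolya1952, Thm. 327] -/
theorem lintegral_enorm_sq_div_infDist_sq_le {K : Set ℝ} (hK : IsClosed K)
    (hne₁ : ∀ t : ℝ, (K ∩ Iic t).Nonempty) (hne₂ : ∀ t : ℝ, (K ∩ Ici t).Nonempty) {t₀ t₁ : ℝ}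
    (ht₀ : t₀ ∈ K) (ht₁ : t₁ ∈ K) {u h : ℝ → E}
    (hum : AEStronglyMeasurable u (volume.restrict (Ioo t₀ t₁)))
    (hh : AEStronglyMeasurable h (volume.restrict (Ioo t₀ t₁)))
    (hu : ∀ s ∈ Icc t₀ t₁, ∀ t ∈ Icc t₀ t₁, u t - u s = ∫ σ in s..t, h σ)
    (hK0 : ∀ t ∈ K ∩ Icc t₀ t₁, u t = 0) :
    ∫⁻ t in Ioo t₀ t₁, ‖u t‖ₑ ^ 2 / ENNReal.ofReal (infDist t K ^ 2) ≤
      8 * ∫⁻ t in Ioo t₀ t₁, ‖h t‖ₑ ^ 2 := by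
  -- off `K` the two one-sided primitives
  have hmemI : ∀ t ∈ Ioo t₀ t₁ \ K, sSup (K ∩ Iic t) ∈ Icc t₀ t₁ ∧ sInf (K ∩ Ici t) ∈ Icc t₀ t₁ := by
    intro t ht
    refine ⟨⟨le_sSup_inter_Iic ht₀ ht.1.1.le, (sSup_inter_Iic_le (hne₁ t)).trans ht.1.2.le⟩, ?_, ?_⟩
    · have h1 : sSup (-K ∩ Iic (-t)) ≤ -t := sSup_inter_Iic_le
        (neg_inter_Iic_nonempty (K := K) (by simpa only [neg_neg] using hne₂ t))
      rw [sSup_neg_inter_Iic] at h1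
      linarith [ht.1.1]
    · have h1 : -t₁ ≤ sSup (-K ∩ Iic (-t)) := le_sSup_inter_Iic (by simpa using ht₁) (neg_le_neg ht.1.2.le)
      rw [sSup_neg_inter_Iic] at h1
      linarith
  have hu₁ : ∀ t ∈ Ioo t₀ t₁ \ K, u t = ∫ s in (sSup (K ∩ Iic t))..t, h s := by
    intro t ht
    have h0 : u (sSup (K ∩ Iic t)) = 0 := hK0 _ ⟨sSup_inter_Iic_mem hK (hne₁ t), (hmemI t ht).1⟩
    have := hu _ (hmemI t ht).1 t (Ioo_subset_Icc_self ht.1)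
    rwa [h0, sub_zero] at this
  have hu₂ : ∀ t ∈ Ioo t₀ t₁ \ K, u t = -∫ s in t..(sInf (K ∩ Ici t)), h s := by
    intro t ht
    have hbmem : sInf (K ∩ Ici t) ∈ K := by
      have h1 := sSup_inter_Iic_mem (K := -K) (hK.preimage continuous_neg) (t := -t)
        (neg_inter_Iic_nonempty (K := K) (by simpa only [neg_neg] using hne₂ t))
      rw [sSup_neg_inter_Iic] at h1
      simpa using h1
    have h0 : u (sInf (K ∩ Ici t)) = 0 := hK0 _ ⟨hbmem, (hmemI t ht).2⟩
    have := hu t (Ioo_subset_Icc_self ht.1) _ (hmemI t ht).2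
    rw [h0, zero_sub] at this
    rw [← this, neg_neg]
  have hA := lintegral_enorm_sq_div_sq_lastZero_le hK hne₁ ht₀ hh hu₁
  have hB := lintegral_enorm_sq_div_sq_nextZero_le hK hne₂ ht₁ hh hu₂
  -- on `K` the integrand vanishes, so integrate over the window minus `K`
  have hzero : ∀ t ∈ Ioo t₀ t₁, t ∈ K → ‖u t‖ₑ ^ 2 / ENNReal.ofReal (infDist t K ^ 2) = 0 := by
    intro t ht htK
    rw [hK0 t ⟨htK, Ioo_subset_Icc_self ht⟩, enorm_zero, zero_pow two_ne_zero, ENNReal.zero_div]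
  have hsplit : ∫⁻ t in Ioo t₀ t₁, ‖u t‖ₑ ^ 2 / ENNReal.ofReal (infDist t K ^ 2) =
      ∫⁻ t in Ioo t₀ t₁ \ K, ‖u t‖ₑ ^ 2 / ENNReal.ofReal (infDist t K ^ 2) := by
    rw [← lintegral_indicator (measurableSet_Ioo.diff hK.measurableSet),
      ← lintegral_indicator measurableSet_Ioo]
    refine lintegral_congr fun t => ?_
    by_cases ht : t ∈ Ioo t₀ t₁
    · by_cases htK : t ∈ K
      · rw [indicator_of_mem ht, indicator_of_notMem (fun h : t ∈ Ioo t₀ t₁ \ K => h.2 htK),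
          hzero t ht htK]
      · rw [indicator_of_mem ht, indicator_of_mem (show t ∈ Ioo t₀ t₁ \ K from ⟨ht, htK⟩)]
    · rw [indicator_of_notMem ht, indicator_of_notMem (fun h : t ∈ Ioo t₀ t₁ \ K => ht h.1)]
  rw [hsplit]
  calc ∫⁻ t in Ioo t₀ t₁ \ K, ‖u t‖ₑ ^ 2 / ENNReal.ofReal (infDist t K ^ 2)
      ≤ ∫⁻ t in Ioo t₀ t₁ \ K, (‖u t‖ₑ ^ 2 / ENNReal.ofReal ((t - sSup (K ∩ Iic t)) ^ 2) +
          ‖u t‖ₑ ^ 2 / ENNReal.ofReal ((sInf (K ∩ Ici t) - t) ^ 2)) := by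
        refine setLIntegral_mono' (measurableSet_Ioo.diff hK.measurableSet) fun t ht => ?_
        rw [ENNReal.div_eq_inv_mul, ENNReal.div_eq_inv_mul, ENNReal.div_eq_inv_mul, ← add_mul]
        exact mul_le_mul_left (inv_infDist_sq_le hK hne₁ hne₂ ht.2) _
    _ = (∫⁻ t in Ioo t₀ t₁ \ K, ‖u t‖ₑ ^ 2 / ENNReal.ofReal ((t - sSup (K ∩ Iic t)) ^ 2)) +
          ∫⁻ t in Ioo t₀ t₁ \ K, ‖u t‖ₑ ^ 2 / ENNReal.ofReal ((sInf (K ∩ Ici t) - t) ^ 2) :=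
        lintegral_add_left' ?_ _
    _ ≤ (4 * ∫⁻ t in Ioo t₀ t₁, ‖h t‖ₑ ^ 2) + 4 * ∫⁻ t in Ioo t₀ t₁, ‖h t‖ₑ ^ 2 := add_le_add hA hB
    _ = 8 * ∫⁻ t in Ioo t₀ t₁, ‖h t‖ₑ ^ 2 := by rw [← add_mul]; norm_num
  -- measurability of the first summand
  · have hum' : AEStronglyMeasurable u (volume.restrict (Ioo t₀ t₁ \ K)) :=
      hum.mono_measure (Measure.restrict_mono sdiff_subset le_rfl)
    have ham : Measurable fun t : ℝ => ENNReal.ofReal ((t - sSup (K ∩ Iic t)) ^ 2) :=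
      (measurable_id.sub (monotone_sSup_inter_Iic hne₁).measurable).pow_const 2 |>.ennreal_ofReal
    exact (hum'.enorm.pow_const 2).div ham.aemeasurable

end Bochner

end Literature.Analysis.Calculus

end
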